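import Literature.NumberTheory.DiophantineApproximation.ViolaZudilinIntegrals
import Literature.NumberTheory.DiophantineApproximation.DilogLandenLinearIndependenceProofs
import Literature.NumberTheory.Transcendental.BeukersZetaThreeIntegralsOffDiagProofs
import HarnessLib

/-!
# The Rhin–Viola base integrals: `∫₀¹ dx/(z−x) = Li₁(1/z)`, `∫₀¹ (−log x) dx/(z−x) = Li₂(1/z)`,
# `∫∫_{[0,1]²} dx dy/(x(1−y)+yz) = log z · Li₁(1/z) + Li₂(1/z)` (Rhin–Viola 2005, Lemma 2.3)

Topic `Literature/NumberTheory/DiophantineApproximation`. Everything here is PROVED (no definitions, no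
named facts). Source: G. Rhin, C. Viola, *The permutation group method for the dilogarithm*, Ann. Sc.
Norm. Super. Pisa Cl. Sci. (5) 4 (2005) 389–437, Lemma 2.3 with (2.10)–(2.14): the base case
`h = j = k = l = m = 0` of their Theorem 2.1 (the arithmetic of the double integrals
`I_z(h, j, k, l, m)`, on which Viola–Zudilin's Lemma 2.1 rests): for `z > 1`,

* (2.11) `I_z^{(1)}(0,0,0,0,0) = ∫₀¹ dx/(z − x) = −log(1 − 1/z) = Li₁(1/z)` — here in the residue
  form `∫₀¹ dx/(z−x)` ((2.10): the inner contour integral of `dy/(x(1−y)+yz)` is `1/(z−x)`);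
* (2.12)–(2.14) `I_z^{(0)}(0,0,0,0,0) = ∫₀¹∫₀¹ dx dy/(x(1−y)+yz) = ∫₀¹ (log z − log x) dx/(z−x)`
  `= log z · Li₁(1/z) + Li₂(1/z)`, using `∫₀¹ (−log x) dx/(z − x) = Li₂(1/z)`;
* hence `I_z(0,…,0) = I_z^{(0)} − (log z) I_z^{(1)} = Li₂(1/z)` (Lemma 2.3).

In the tree's vocabulary the double integral is `∫ p in ViolaZudilin.unitSquare, ViolaZudilin.weight z p`
(`ViolaZudilinIntegrals.lean`; `weight z (x,y) = 1/(x(1−y)+yz)`), i.e. `J_z^{(0)}` of Viola–Zudilin with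
all six parameters `0`, and `Li_s = DilogPade.polylogSeries s`.

## References

* G. Rhin, C. Viola, Ann. Sc. Norm. Super. Pisa Cl. Sci. (5) 4 (2005) 389–437, Lemma 2.3, (2.10)–(2.14).
  [RhinViola2005]
* C. Viola, W. Zudilin, J. reine angew. Math. 736 (2018) 193–223, §2.1. [ViolaZudilin2018]
-/

noncomputable section

namespace Literature.NumberTheory.DiophantineApproximation

namespace RhinViola

open _root_.MeasureTheory _root_.Set _root_.Filter _root_.Topology intervalIntegral
open DilogPade (polylogSeries)
open Literature.Analysis.SpecialFunctions (realDilog)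
open ViolaZudilin (unitSquare weight denom₁)

/-! ### The dilogarithm series as a `HasSum` -/

/-- For `|t| < 1`, `Σ_{k≥0} t^{k+1}/(k+1)² = Li₂(t)` as a `HasSum` (comparison with the geometric
series). [folklore] -/
theorem hasSum_realDilog {t : ℝ} (ht : |t| < 1) :
    HasSum (fun k : ℕ => t ^ (k + 1) / ((k : ℝ) + 1) ^ 2) (realDilog t) := by
  have hs : Summable fun k : ℕ => t ^ (k + 1) / ((k : ℝ) + 1) ^ 2 := by
    refine Summable.of_norm_bounded ((summable_geometric_of_lt_one (abs_nonneg t) ht).mul_left |t|)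
      fun k => ?_
    have hk2 : (0 : ℝ) < ((k : ℝ) + 1) ^ 2 := by positivity
    have hk1 : (1 : ℝ) ≤ ((k : ℝ) + 1) ^ 2 := by
      have : (1 : ℝ) ≤ (k : ℝ) + 1 := by simp
      nlinarith
    rw [Real.norm_eq_abs, abs_div, abs_pow, abs_of_pos hk2, pow_succ']
    exact div_le_self (by positivity) hk1
  exact hs.hasSum

/-! ### One-dimensional integrals -/

/-- **(RV (2.11))** `∫₀¹ dx/(z − x) = log z − log(z − 1) = −log(1 − 1/z) = Li₁(1/z)` for `z > 1`.
[cite: RhinViola2005, (2.10)–(2.11)] -/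
theorem integral_one_div_sub {z : ℝ} (hz : 1 < z) :
    ∫ x in (0 : ℝ)..1, 1 / (z - x) = polylogSeries 1 (1 / z) := by
  have hz0 : 0 < z := zero_lt_one.trans hz
  have hderiv : ∀ x ∈ uIcc (0 : ℝ) 1, HasDerivAt (fun x : ℝ => -Real.log (z - x)) (1 / (z - x)) x := by
    intro x hx
    rw [uIcc_of_le zero_le_one] at hx
    have hzx : z - x ≠ 0 := by linarith [hx.2]
    have h : HasDerivAt (fun x : ℝ => -Real.log (z - x)) (-((z - x)⁻¹ * -1)) x :=
      ((Real.hasDerivAt_log hzx).comp x ((hasDerivAt_id x).const_sub z)).neg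
    refine h.congr_deriv ?_
    field_simp
  have hcont : ContinuousOn (fun x : ℝ => 1 / (z - x)) (uIcc (0 : ℝ) 1) := by
    refine continuousOn_const.div (continuousOn_const.sub continuousOn_id) fun x hx => ?_
    rw [uIcc_of_le zero_le_one] at hx
    linarith [hx.2]
  rw [integral_eq_sub_of_hasDerivAt hderiv (hcont.intervalIntegrable),
    ViolaZudilin.polylogSeries_one_eq_neg_log
      (by rw [abs_of_pos (one_div_pos.2 hz0)]; exact (div_lt_one hz0).2 hz)]
  have h1 : 1 - 1 / z = (z - 1) / z := by field_simp
  rw [h1, Real.log_div (by linarith) hz0.ne']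
  simp only [sub_zero]
  ring

/-- **(RV (2.14))** `∫₀¹ (−log x) dx/(z − x) = Li₂(1/z)` for `z > 1`: expand
`1/(z−x) = Σ x^k/z^{k+1}` and integrate `∫₀¹ x^k (−log x) dx = 1/(k+1)²` term by term (the terms are
non-negative). [cite: RhinViola2005, (2.14)] -/
theorem integral_neg_log_div_sub {z : ℝ} (hz : 1 < z) :
    ∫ x in Ioo (0 : ℝ) 1, -Real.log x / (z - x) = polylogSeries 2 (1 / z) := by
  have hz0 : 0 < z := zero_lt_one.trans hz
  set g : ℕ → ℝ → ℝ := fun k x => (1 / z) ^ (k + 1) * (x ^ k * -Real.log x) with hg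
  -- integrability and value of each term
  have hgi : ∀ k, IntegrableOn (g k) (Ioo (0 : ℝ) 1) := fun k =>
    (Literature.NumberTheory.Transcendental.Beukers.integrableOn_pow_mul_neg_log_Ioo_zero_one k).const_mul _
  have hgv : ∀ k, ∫ x in Ioo (0 : ℝ) 1, g k x = (1 / z) ^ (k + 1) / ((k : ℝ) + 1) ^ 2 := by
    intro k
    simp only [hg]
    rw [MeasureTheory.integral_const_mul,
      Literature.NumberTheory.Transcendental.Beukers.integral_pow_mul_neg_log_Ioo_zero_one]
    ring
  -- pointwise expansion on `(0,1)`
  have hexp : EqOn (fun x => ∑' k, g k x) (fun x => -Real.log x / (z - x)) (Ioo (0 : ℝ) 1) := by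
    intro x hx
    show ∑' k, g k x = -Real.log x / (z - x)
    have hx0 : 0 ≤ x / z := div_nonneg hx.1.le hz0.le
    have hx1 : x / z < 1 := (div_lt_one hz0).2 (hx.2.trans hz)
    have hs := (hasSum_geometric_of_lt_one hx0 hx1).mul_left (-Real.log x / z)
    have hval : -Real.log x / z * (1 - x / z)⁻¹ = -Real.log x / (z - x) := by
      have : z - x ≠ 0 := by linarith [hx.2]
      field_simp
    rw [hval] at hs
    have hs' : HasSum (fun k => g k x) (-Real.log x / (z - x)) := by
      refine hs.congr_fun fun k => ?_
      simp only [hg]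
      rw [div_pow, div_pow, one_pow, pow_succ]
      field_simp
    exact hs'.tsum_eq
  -- non-negativity of the terms and summability of their integrals
  have hnorm : ∀ k, ∫ x in Ioo (0 : ℝ) 1, ‖g k x‖ = ∫ x in Ioo (0 : ℝ) 1, g k x := fun k =>
    setIntegral_congr_fun measurableSet_Ioo fun x hx => by
      simp only [hg]
      exact Real.norm_of_nonneg (mul_nonneg (by positivity) (mul_nonneg (pow_nonneg hx.1.le _)
        (neg_nonneg.2 (Real.log_nonpos hx.1.le hx.2.le))))
  have hS := hasSum_realDilog (t := 1 / z)
    (by rw [abs_of_pos (one_div_pos.2 hz0)]; exact (div_lt_one hz0).2 hz)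
  have hsum : Summable fun k => ∫ x in Ioo (0 : ℝ) 1, ‖g k x‖ :=
    hS.summable.congr fun k => ((hnorm k).trans (hgv k)).symm
  rw [← setIntegral_congr_fun measurableSet_Ioo hexp,
    ← integral_tsum_of_summable_integral_norm hgi hsum, tsum_congr hgv,
    ViolaZudilin.polylogSeries_two_eq_realDilog]
  exact hS.tsum_eq

/-- **The inner integral (RV (2.12))**: for `0 < x < z`,
`∫₀¹ dy/(x(1−y) + yz) = (log z − log x)/(z − x)` (primitive `log(x + y(z−x))/(z−x)`).
[cite: RhinViola2005, (2.12)] -/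
theorem integral_weight_section {z x : ℝ} (hx : 0 < x) (hxz : x < z) :
    ∫ y in (0 : ℝ)..1, 1 / (x * (1 - y) + y * z) = (Real.log z - Real.log x) / (z - x) := by
  have hzx : z - x ≠ 0 := by linarith
  have hpos : ∀ y ∈ uIcc (0 : ℝ) 1, 0 < x + y * (z - x) := by
    intro y hy
    rw [uIcc_of_le zero_le_one] at hy
    nlinarith [hy.1]
  have hderiv : ∀ y ∈ uIcc (0 : ℝ) 1,
      HasDerivAt (fun y : ℝ => Real.log (x + y * (z - x)) / (z - x)) (1 / (x * (1 - y) + y * z)) y := by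
    intro y hy
    have hy0 := (hpos y hy).ne'
    have h : HasDerivAt (fun y : ℝ => Real.log (x + y * (z - x)) / (z - x))
        ((x + y * (z - x))⁻¹ * (1 * (z - x)) / (z - x)) y :=
      ((Real.hasDerivAt_log hy0).comp y (((hasDerivAt_id y).mul_const (z - x)).const_add x)).div_const
        (z - x)
    refine h.congr_deriv ?_
    rw [show x * (1 - y) + y * z = x + y * (z - x) by ring]
    field_simp
  have hcont : ContinuousOn (fun y : ℝ => 1 / (x * (1 - y) + y * z)) (uIcc (0 : ℝ) 1) := by
    refine continuousOn_const.div (by fun_prop) fun y hy => ?_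
    have : x * (1 - y) + y * z = x + y * (z - x) := by ring
    rw [this]
    exact (hpos y hy).ne'
  rw [integral_eq_sub_of_hasDerivAt hderiv hcont.intervalIntegrable]
  simp only [zero_mul, add_zero, one_mul, add_sub_cancel]
  rw [sub_div]

/-! ### The double integral (RV Lemma 2.3) -/

/-- **Rhin–Viola 2005, (2.12)–(2.14): `∫∫_{[0,1]²} dx dy/(x(1−y)+yz) = log z · Li₁(1/z) + Li₂(1/z)`**
for `z > 1` — the value of `I_z^{(0)}(0,0,0,0,0)` (equivalently of Viola–Zudilin's `J_z^{(0)}` with all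
parameters `0`): Fubini (the weight is integrable, `ViolaZudilin.integrableOn_weight`), the inner
integral `(log z − log x)/(z − x)`, and the two one-dimensional evaluations above.
[cite: RhinViola2005, Lemma 2.3, (2.12)–(2.14)] -/
theorem setIntegral_weight_unitSquare {z : ℝ} (hz : 1 < z) :
    ∫ p in unitSquare, weight z p = Real.log z * polylogSeries 1 (1 / z) + polylogSeries 2 (1 / z) := by
  have hz0 : 0 < z := zero_lt_one.trans hz
  -- Fubini on the square
  have hint : Integrable (weight z)
      (((volume : Measure ℝ).restrict (Icc 0 1)).prod ((volume : Measure ℝ).restrict (Icc 0 1))) := by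
    have h := ViolaZudilin.integrableOn_weight hz.le
    rwa [IntegrableOn, ViolaZudilin.volume_restrict_unitSquare] at h
  have hF : ∫ p in unitSquare, weight z p =
      ∫ x in Icc (0 : ℝ) 1, ∫ y in Icc (0 : ℝ) 1, weight z (x, y) := by
    rw [show (∫ p in unitSquare, weight z p) = ∫ p, weight z p
        ∂((volume : Measure ℝ).restrict (Icc 0 1)).prod ((volume : Measure ℝ).restrict (Icc 0 1)) by
      rw [← ViolaZudilin.volume_restrict_unitSquare]]
    exact integral_prod _ hint
  -- the inner integral, for `0 < x ≤ 1`
  have hinner : EqOn (fun x : ℝ => ∫ y in Icc (0 : ℝ) 1, weight z (x, y))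
      (fun x => Real.log z * (1 / (z - x)) + -Real.log x / (z - x)) (Ioc (0 : ℝ) 1) := by
    intro x hx
    simp only
    rw [integral_Icc_eq_integral_Ioc, ← integral_of_le zero_le_one]
    have h := integral_weight_section hx.1 (hx.2.trans_lt hz)
    simp only [weight, denom₁] at h ⊢
    rw [h]
    ring
  rw [hF, integral_Icc_eq_integral_Ioc, setIntegral_congr_fun measurableSet_Ioc hinner]
  -- split the outer integral
  have h1 : IntegrableOn (fun x : ℝ => Real.log z * (1 / (z - x))) (Ioc (0 : ℝ) 1) := by
    refine ContinuousOn.integrableOn_Icc ?_ |>.mono_set Ioc_subset_Icc_self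
    exact continuousOn_const.mul (continuousOn_const.div (continuousOn_const.sub continuousOn_id)
      fun x hx => by linarith [hx.2])
  have h2 : IntegrableOn (fun x : ℝ => -Real.log x / (z - x)) (Ioc (0 : ℝ) 1) := by
    -- `|−log x/(z−x)| ≤ |log x|/(z−1)` and `log` is integrable on `(0,1)`
    have hlog : IntegrableOn (fun x : ℝ => Real.log x) (Ioc (0 : ℝ) 1) :=
      (intervalIntegrable_iff_integrableOn_Ioc_of_le zero_le_one).1 intervalIntegrable_log'
    refine (hlog.norm.const_mul (1 / (z - 1))).mono' ?_ ?_
    · refine (Real.measurable_log.neg.div (measurable_const.sub measurable_id)).aestronglyMeasurable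
    · filter_upwards [ae_restrict_mem measurableSet_Ioc] with x hx
      rw [Real.norm_eq_abs, abs_div, abs_neg, abs_of_pos (by linarith [hx.2] : (0 : ℝ) < z - x),
        Real.norm_eq_abs]
      rw [div_eq_mul_inv, one_div, mul_comm (z - 1)⁻¹]
      exact mul_le_mul_of_nonneg_left ((inv_le_inv₀ (by linarith [hx.2]) (by linarith)).2
        (by linarith [hx.2])) (abs_nonneg _)
  rw [integral_add h1 h2, MeasureTheory.integral_const_mul, ← integral_of_le zero_le_one,
    integral_one_div_sub hz, integral_Ioc_eq_integral_Ioo, integral_neg_log_div_sub hz]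

/-- **Rhin–Viola 2005, Lemma 2.3**: `I_z(0,0,0,0,0) = I_z^{(0)} − (log z) I_z^{(1)} = Li₂(1/z)` for
`z > 1`, with `I_z^{(0)}(0,…,0) = ∫∫_{[0,1]²} dx dy/(x(1−y)+yz)` and `I_z^{(1)}(0,…,0) = ∫₀¹ dx/(z−x)` (its
residue form (2.10)–(2.11)). [cite: RhinViola2005, Lemma 2.3] -/
theorem setIntegral_weight_sub_log_mul {z : ℝ} (hz : 1 < z) :
    (∫ p in unitSquare, weight z p) - Real.log z * ∫ x in (0 : ℝ)..1, 1 / (z - x) =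
      polylogSeries 2 (1 / z) := by
  rw [setIntegral_weight_unitSquare hz, integral_one_div_sub hz]
  ring

/-- The same in Viola–Zudilin's notation: `J_z^{(0)}` with all six parameters `0` (and any `n`) is
`log z · Li₁(1/z) + Li₂(1/z)`. [cite: ViolaZudilin2018, §2.1; RhinViola2005, (2.12)–(2.14)] -/
theorem J0_zero_params {z : ℝ} (hz : 1 < z) (n : ℕ) :
    ViolaZudilin.J0 z ⟨0, 0, 0, 0, 0, 0⟩ n = Real.log z * polylogSeries 1 (1 / z) + polylogSeries 2 (1 / z) := by
  rw [ViolaZudilin.J0, ← setIntegral_weight_unitSquare hz]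
  have hb : ∀ p, ViolaZudilin.base z ⟨0, 0, 0, 0, 0, 0⟩ p = 1 := fun p => by
    simp [ViolaZudilin.base]
  simp [hb]

end RhinViola

end Literature.NumberTheory.DiophantineApproximation

end
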